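import Literature.NumberTheory.EllipticCurves.Gamma0EisensteinWeightOneAllPairs
import Literature.NumberTheory.EllipticCurves.EisensteinWeightOneRowContinuation
import HarnessLib

/-!
# The all-pairs weight-one Eisenstein sum as a sum of rows

Topic `Literature/NumberTheory/EllipticCurves`; namespace
`Literature.NumberTheory.EllipticCurves.ModularForms`. One definition with a body (`chiZ`, the
Dirichlet character read on `ℤ`) and theorems; no named fact.

For an ODD Dirichlet character `χ` mod `M` (`χ(-1) = -1`; for even `χ` the weight-one series vanish
identically) and `z ∈ ℍ`, `Re s > 1/2`, the sum over all pairs of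
`Gamma0EisensteinWeightOneAllPairs.lean` decomposes into its rows `c = M c″`:

  **`G(z, s) = 2 yˢ L(χ, 1 + 2s) + 2 yˢ ∑_{c' ≥ 0} R(χ, M(c'+1) z, s)`**
  (`eisensteinOneAll_eq_rows`)

where `R(χ, w, s) = ∑_{d ∈ ℤ} χ(d) (d + w)^{-1-s} (d + w̄)^{-s}` is the row of
`EisensteinWeightOneRowContinuation.lean` (`rowSum`): the row `c = 0` is
`∑_{d ≠ 0} χ(d) d⁻¹ (y/d²)ˢ = 2 yˢ L(χ, 1 + 2s)` (pairing `d ↔ -d`, `χ` odd), the rows `±c` agree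
(`e1Term_neg`), and on a row `c > 0` the summand is `yˢ χ(d) k(cz, s; d)` (`e1Term_row`). With
`R = R̃` on `Re s > 0` (`rowSum_eq_rowCont`) this is the form continued to `Re s > -1/2` in the next
file. Steps: `eisensteinOneAll_eq_tsum_prod` (the pairs with `M ∣ c` are `(M c″, d)`,
`Function.Injective.tsum_eq`), `tsum_int_even_eq` (an even absolutely convergent `ℤ`-series is
`F(0) + 2 ∑_{n ≥ 0} F(n+1)`), `tsum_row_zero` (the row `c = 0`), `tsum_row_pos` (the rows `c > 0`).

## References

* E. Hecke, *Theorie der Eisensteinschen Reihen höherer Stufe…*, Abh. Math. Sem. Hamburg 5 (1927),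
  §§1–2.
* B. Schoeneberg, *Elliptic Modular Functions*, Springer (1974), Ch. VII §2.
-/

noncomputable section

open Complex UpperHalfPlane Filter
open scoped Topology Real ComplexConjugate

namespace Literature.NumberTheory.EllipticCurves.ModularForms

variable {M : ℕ} (χ : DirichletCharacter ℂ M)

/-- The Dirichlet character read on `ℤ`: `χℤ(d) = χ(d mod M)`. [folklore] -/
def chiZ (d : ℤ) : ℂ := χ (d : ZMod M)

/-- Unfolding `chiZ`. [folklore] -/
@[simp] theorem chiZ_apply (d : ℤ) : chiZ χ d = χ (d : ZMod M) := rfl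

/-- `χℤ` is `M`-periodic. [folklore] -/
theorem chiZ_periodic : Function.Periodic (chiZ χ) (M : ℤ) := by
  intro d; simp [chiZ]

/-- `∑_{i mod M} χ(i) = 0` for `χ ≠ 1`. [folklore] -/
theorem sum_range_chiZ_eq_zero [NeZero M] (hχ : χ ≠ 1) :
    ∑ i ∈ Finset.range M, chiZ χ i = 0 := by
  have h := MulChar.sum_eq_zero_of_ne_one hχ
  obtain ⟨n, rfl⟩ : ∃ n, M = n + 1 := Nat.exists_eq_succ_of_ne_zero (NeZero.ne M)
  rw [Finset.sum_range (fun i ↦ chiZ χ i), ← h]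
  refine Fintype.sum_bijective (fun i : Fin (n + 1) ↦ (show ZMod (n + 1) from i))
    Function.bijective_id _ _ fun i ↦ ?_
  rw [chiZ_apply, Int.cast_natCast]
  exact congrArg χ (ZMod.natCast_zmod_val (show ZMod (n + 1) from i))

/-- An odd character is non-trivial. [folklore] -/
theorem ne_one_of_odd (hodd : χ.Odd) : χ ≠ 1 := by
  intro h
  rw [h, DirichletCharacter.Odd, MulChar.one_apply (isUnit_one.neg)] at hodd
  norm_num at hodd

/-! ### Symmetries of the summand -/

/-- **`e_{-v} = e_v` for odd `χ`.** [folklore] -/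
theorem e1Term_neg (hodd : χ.Odd) (s : ℂ) (v : Fin 2 → ℤ) (z : ℍ) :
    e1Term χ s (-v) z = e1Term χ s v z := by
  unfold e1Term e1Base
  simp only [Pi.neg_apply, Int.cast_neg]
  have hχ : χ (-(v 1 : ZMod M)) = -χ (v 1) := by
    rw [neg_eq_neg_one_mul, map_mul]
    rw [DirichletCharacter.Odd] at hodd
    rw [hodd]; ring
  rw [hχ, show -(v 0 : ℂ) * (z : ℂ) + -(v 1 : ℂ) = -((v 0 : ℂ) * z + v 1) by ring, norm_neg,
    inv_neg]
  ring

/-- **The summand on a row `c > 0`**: `e_{(c,d)}(z, s) = yˢ χ(d) k(cz, s; d)` with the row kernel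
`k` of `EisensteinWeightOneRowKernel.lean`. [folklore] -/
theorem e1Term_row {c : ℤ} (hc : 0 < c) (s : ℂ) (d : ℤ) (z : ℍ) :
    e1Term χ s ![c, d] z =
      ((z.im : ℝ) : ℂ) ^ s * (chiZ χ d * rowKernel ((c : ℂ) * z) s d) := by
  have hw : 0 < ((c : ℂ) * z).im := by
    rw [show ((c : ℂ)) = ((c : ℝ) : ℂ) by norm_cast, Complex.im_ofReal_mul (c : ℝ) (z : ℂ)]
    exact mul_pos (by exact_mod_cast hc) z.im_pos
  rw [rowKernel_eq_inv_mul_inv_cpow hw]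
  unfold e1Term e1Base
  simp only [Matrix.cons_val_zero, Matrix.cons_val_one, chiZ_apply]
  have hL : (d : ℂ) + (c : ℂ) * z = (c : ℂ) * z + d := by ring
  rw [ofReal_intCast, hL, div_eq_mul_inv, ofReal_mul,
    mul_cpow_ofReal_nonneg z.im_pos.le (by positivity)]
  ring

/-! ### The pairs with `M ∣ c` are `(M c″, d)` -/

/-- **`G(z, s) = ∑_{(c″, d) ∈ ℤ²} e_{(M c″, d)}(z, s)`** (the summand `gTerm` vanishes off
`M ∣ c`; no convergence needed). [folklore] -/
theorem eisensteinOneAll_eq_tsum_prod (hM : 0 < M) (s : ℂ) (z : ℍ) :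
    eisensteinOneAll χ z s = ∑' p : ℤ × ℤ, e1Term χ s ![(M : ℤ) * p.1, p.2] z := by
  set g : ℤ × ℤ → (Fin 2 → ℤ) := fun p ↦ ![(M : ℤ) * p.1, p.2] with hg
  have hinj : Function.Injective g := by
    intro p q h
    simp only [hg] at h
    have h0 := congrFun h 0
    have h1 := congrFun h 1
    simp only [Matrix.cons_val_zero, Matrix.cons_val_one] at h0 h1
    have hM' : (M : ℤ) ≠ 0 := by exact_mod_cast hM.ne'
    exact Prod.ext (mul_left_cancel₀ hM' h0) h1
  have hsupp : Function.support (fun v : Fin 2 → ℤ ↦ gTerm χ s v z) ⊆ Set.range g := by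
    intro v hv
    rw [Function.mem_support] at hv
    unfold gTerm at hv
    by_cases h : (M : ℤ) ∣ v 0
    · obtain ⟨c, hc⟩ := h
      refine ⟨(c, v 1), ?_⟩
      simp only [hg]
      ext i; fin_cases i <;> simp [hc]
    · exact absurd (if_neg h) hv
  unfold eisensteinOneAll
  rw [← hinj.tsum_eq hsupp]
  refine tsum_congr fun p ↦ ?_
  simp [hg, gTerm]

/-- Summability of the reparametrised family for `Re s > 1/2`. [folklore] -/
theorem summable_e1Term_prod (hM : 0 < M) {s : ℂ} (hs : 1 / 2 < s.re) (z : ℍ) :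
    Summable fun p : ℤ × ℤ ↦ e1Term χ s ![(M : ℤ) * p.1, p.2] z := by
  set g : ℤ × ℤ → (Fin 2 → ℤ) := fun p ↦ ![(M : ℤ) * p.1, p.2] with hg
  have hinj : Function.Injective g := by
    intro p q h
    simp only [hg] at h
    have h0 := congrFun h 0
    have h1 := congrFun h 1
    simp only [Matrix.cons_val_zero, Matrix.cons_val_one] at h0 h1
    have hM' : (M : ℤ) ≠ 0 := by exact_mod_cast hM.ne'
    exact Prod.ext (mul_left_cancel₀ hM' h0) h1
  have h := (summable_gTerm χ hs z).comp_injective hinj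
  refine h.congr fun p ↦ ?_
  simp [hg, gTerm, Function.comp]

/-! ### Even `ℤ`-series -/

/-- An even summable `ℤ`-series: `∑_{c ∈ ℤ} F(c) = F(0) + 2 ∑_{n ≥ 0} F(n+1)`. [folklore] -/
theorem tsum_int_even_eq {F : ℤ → ℂ} (hF : Summable F) (heven : ∀ c : ℤ, F (-c) = F c) :
    ∑' c : ℤ, F c = F 0 + 2 * ∑' n : ℕ, F ((n : ℤ) + 1) := by
  have h := hF.hasSum.nat_add_neg
  have h2 : HasSum (fun n : ℕ ↦ 2 * F n) (∑' c : ℤ, F c + F 0) := by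
    refine h.congr_fun fun n ↦ ?_
    rw [heven]; ring
  have hsF : Summable fun n : ℕ ↦ F n := by
    have := h2.summable.mul_left (2⁻¹ : ℂ)
    refine this.congr fun n ↦ ?_
    ring
  have h3 : ∑' n : ℕ, 2 * F n = 2 * (F 0 + ∑' n : ℕ, F ((n : ℤ) + 1)) := by
    rw [tsum_mul_left, hsF.tsum_eq_zero_add]
    push_cast
    ring_nf
  have h4 := h2.tsum_eq
  rw [h3] at h4
  linear_combination -h4

/-! ### The row `c = 0` -/

/-- The summand on the row `c = 0`: `e_{(0,d)}(z, s) = yˢ χ(d) d⁻¹ (d²)^{-s}` for `d > 0`, in the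
`L`-series form `yˢ χ(d) d^{-(1+2s)}`. [folklore] -/
theorem e1Term_row_zero_nat (s : ℂ) {d : ℕ} (hd : 0 < d) (z : ℍ) :
    e1Term χ s ![0, (d : ℤ)] z =
      ((z.im : ℝ) : ℂ) ^ s * LSeries.term (fun n : ℕ ↦ χ n) (1 + 2 * s) d := by
  have hd0 : (d : ℂ) ≠ 0 := by exact_mod_cast hd.ne'
  unfold e1Term e1Base
  simp only [Matrix.cons_val_zero, Matrix.cons_val_one, Int.cast_zero, zero_mul, zero_add,
    Int.cast_natCast, Complex.norm_natCast]
  rw [LSeries.term_of_ne_zero hd.ne', div_eq_mul_inv (z.im), ofReal_mul,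
    mul_cpow_ofReal_nonneg z.im_pos.le (by positivity), ofReal_inv_sq_cpow hd,
    div_eq_mul_inv, ← cpow_neg, show -(1 + 2 * s) = (-1 : ℂ) + (-2 * s) by ring,
    cpow_add _ _ hd0, cpow_neg_one]
  ring

/-- **The row `c = 0`**: `∑_{d ∈ ℤ} e_{(0,d)}(z, s) = 2 yˢ L(χ, 1 + 2s)` for odd `χ` and
`Re s > 1/2`. [folklore] -/
theorem tsum_row_zero [NeZero M] (hodd : χ.Odd) {s : ℂ} (hs : 1 / 2 < s.re) (z : ℍ) :
    ∑' d : ℤ, e1Term χ s ![(M : ℤ) * 0, d] z =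
      2 * ((z.im : ℝ) : ℂ) ^ s * χ.LFunction (1 + 2 * s) := by
  have h2s : 1 < (1 + 2 * s).re := by simp; linarith
  simp only [mul_zero]
  -- summability of the row (a sub-family of the summable family over `ℤ²`)
  have hF : Summable fun d : ℤ ↦ e1Term χ s ![0, d] z := by
    have h := (summable_e1Term_prod χ (Nat.pos_of_ne_zero (NeZero.ne M)) hs z).comp_injective
      (Prod.mk_right_injective (0 : ℤ))
    refine h.congr fun d ↦ ?_
    simp [Function.comp]
  have heven : ∀ d : ℤ, e1Term χ s ![0, -d] z = e1Term χ s ![0, d] z := by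
    intro d
    have := e1Term_neg χ hodd s ![0, d] z
    rw [← this]
    congr 1
    ext i; fin_cases i <;> simp
  rw [tsum_int_even_eq hF heven]
  have h0 : e1Term χ s ![0, (0 : ℤ)] z = 0 := by
    have : (![0, (0 : ℤ)] : Fin 2 → ℤ) = 0 := by ext i; fin_cases i <;> rfl
    rw [this, e1Term_zero_vec]
  rw [h0, zero_add, DirichletCharacter.LFunction_eq_LSeries χ h2s, LSeries,
    (DirichletCharacter.LSeriesSummable_of_one_lt_re χ h2s).tsum_eq_zero_add, LSeries.term_zero,
    zero_add, ← tsum_mul_left, ← tsum_mul_left]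
  refine tsum_congr fun n ↦ ?_
  have := e1Term_row_zero_nat χ s (Nat.succ_pos n) z
  push_cast at this ⊢
  rw [this]
  ring

/-! ### The rows `c > 0` and `c < 0` -/

/-- **A row `c = M(n+1) > 0`**: `∑_d e_{(c,d)}(z, s) = yˢ R(χℤ, cz, s)`. [folklore] -/
theorem tsum_row_pos (hM : 0 < M) (s : ℂ) (n : ℕ) (z : ℍ) :
    ∑' d : ℤ, e1Term χ s ![(M : ℤ) * ((n : ℤ) + 1), d] z =
      ((z.im : ℝ) : ℂ) ^ s * rowSum (chiZ χ) ((((M : ℤ) * ((n : ℤ) + 1) : ℤ) : ℂ) * z) s := by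
  have hc : 0 < (M : ℤ) * ((n : ℤ) + 1) := by
    have : (0 : ℤ) < M := by exact_mod_cast hM
    positivity
  unfold rowSum
  rw [← tsum_mul_left]
  exact tsum_congr fun d ↦ e1Term_row χ hc s d z

/-- The rows `c` and `-c` agree (odd `χ`). [folklore] -/
theorem tsum_row_neg (hodd : χ.Odd) (s : ℂ) (c : ℤ) (z : ℍ) :
    ∑' d : ℤ, e1Term χ s ![(M : ℤ) * (-c), d] z = ∑' d : ℤ, e1Term χ s ![(M : ℤ) * c, d] z := by
  rw [← (Equiv.neg ℤ).tsum_eq]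
  refine tsum_congr fun d ↦ ?_
  have := e1Term_neg χ hodd s ![(M : ℤ) * c, d] z
  rw [← this]
  congr 1
  ext i; fin_cases i <;> simp

/-! ### Assembly -/

/-- **`G(z, s) = 2 yˢ L(χ, 1 + 2s) + 2 yˢ ∑_{c' ≥ 0} R(χℤ, M(c'+1) z, s)`** for odd `χ` and
`Re s > 1/2` (Hecke 1927, §2; Schoeneberg VII §2). [folklore] -/
theorem eisensteinOneAll_eq_rows [NeZero M] (hodd : χ.Odd) {s : ℂ} (hs : 1 / 2 < s.re) (z : ℍ) :
    eisensteinOneAll χ z s = 2 * ((z.im : ℝ) : ℂ) ^ s * χ.LFunction (1 + 2 * s) +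
      2 * ((z.im : ℝ) : ℂ) ^ s *
        ∑' n : ℕ, rowSum (chiZ χ) ((((M : ℤ) * ((n : ℤ) + 1) : ℤ) : ℂ) * z) s := by
  have hM : 0 < M := Nat.pos_of_ne_zero (NeZero.ne M)
  have hsum := summable_e1Term_prod χ hM hs z
  rw [eisensteinOneAll_eq_tsum_prod χ hM s z, hsum.tsum_prod]
  -- the `c″`-series is even and summable
  have hrows : Summable fun c : ℤ ↦ ∑' d : ℤ, e1Term χ s ![(M : ℤ) * c, d] z := hsum.prod
  have key : ∑' n : ℕ, (∑' d : ℤ, e1Term χ s ![(M : ℤ) * ((n : ℤ) + 1), d] z) =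
      ((z.im : ℝ) : ℂ) ^ s *
        ∑' n : ℕ, rowSum (chiZ χ) ((((M : ℤ) * ((n : ℤ) + 1) : ℤ) : ℂ) * z) s := by
    rw [← tsum_mul_left]
    exact tsum_congr fun n ↦ tsum_row_pos χ hM s n z
  rw [tsum_int_even_eq hrows (fun c ↦ tsum_row_neg χ hodd s c z), tsum_row_zero χ hodd hs z, key]
  ring

/-- The same with the continued rows `R̃` (`rowSum = rowCont` on `Re s > 0`). [folklore] -/
theorem eisensteinOneAll_eq_rowCont [NeZero M] (hodd : χ.Odd) {s : ℂ} (hs : 1 / 2 < s.re) (z : ℍ) :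
    eisensteinOneAll χ z s = 2 * ((z.im : ℝ) : ℂ) ^ s * χ.LFunction (1 + 2 * s) +
      2 * ((z.im : ℝ) : ℂ) ^ s *
        ∑' n : ℕ, rowCont M (chiZ χ) ((((M : ℤ) * ((n : ℤ) + 1) : ℤ) : ℂ) * z) s := by
  have hM : 0 < M := Nat.pos_of_ne_zero (NeZero.ne M)
  rw [eisensteinOneAll_eq_rows χ hodd hs z]
  congr 2
  refine tsum_congr fun n ↦ ?_
  have hw : 0 < ((((M : ℤ) * ((n : ℤ) + 1) : ℤ) : ℂ) * z).im := by
    rw [show ((((M : ℤ) * ((n : ℤ) + 1) : ℤ) : ℂ)) = (((M : ℝ) * ((n : ℝ) + 1) : ℝ) : ℂ) by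
      push_cast; ring, Complex.im_ofReal_mul]
    have : (0 : ℝ) < M := by exact_mod_cast hM
    exact mul_pos (by positivity) z.im_pos
  exact rowSum_eq_rowCont hM (chiZ_periodic χ) (sum_range_chiZ_eq_zero χ (ne_one_of_odd χ hodd))
    hw (by linarith)

end Literature.NumberTheory.EllipticCurves.ModularForms
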